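import Summits.NavierStokesRegularity.FluidComputer.PalasekTowerHeredityOrBreakdownCeiling

/-! # Sub-skeleton of the UPPER stub `stub_apriori_ceiling : AprioriCeiling` of crux `HeredityFromTwo`
(item stmt-NavierStokesRegularity-19250, skeleton v3 c7f4b5fa45c722f3) — START-HERE-D0081 §C.2 deliverable of the
stub-worker ns-palasek-19250-p2 (g2). NOT a re-cut of the crux skeleton (the registered stubs are untouched); two
sub-stubs composing to the registered upper stub BY NAME through the LOSSLESS split
`aprioriCeiling_iff_noPrematureBreakdown_and_windowCeiling` (p473580):

* `stub_no_premature_breakdown : ∀ k ≥ 2, NoPrematureBreakdownAt k` — «no registered level-`k` design's flow dies inside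
  window `k`»; ITS FALSITY IS FEFFERMAN'S (C) (`navierStokesBreakdownR3_of_not_noPrematureBreakdownAt`, p473253) — not a
  kill path of the route;
* `stub_window_ceiling : ∀ k ≥ 2, WindowCeilingAt k` — no SURVIVING registered flow overshoots `c₂ Y_{k+1}` on its window
  (the genuine NS content; OPEN, a bet on the registered class like the floors).

WHAT THIS IS NOT: not NS; nothing decided; two `sorry`s = two sub-stubs. -/

namespace Summit.NavierStokesRegularity.FluidComputer.PalasekTowerClayBridge.BirthHeredityFromTwo.AprioriCeilingLine

/-- sub-stub 1/2 of `stub_apriori_ceiling`: no premature breakdown at the generic levels («(C) if false»). -/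
theorem stub_no_premature_breakdown : ∀ k : ℕ, 2 ≤ k → NoPrematureBreakdownAt k := by
  sorry

/-- sub-stub 2/2 of `stub_apriori_ceiling`: the window ceiling of the survivors at the generic levels. -/
theorem stub_window_ceiling : ∀ k : ℕ, 2 ≤ k → WindowCeilingAt k := by
  sorry

/-- The composition: the registered upper stub BY NAME from the two sub-stubs (lossless:
`aprioriCeiling_iff_noPrematureBreakdown_and_windowCeiling` is an `↔`). -/
theorem AprioriCeiling_of : (∀ k : ℕ, 2 ≤ k → NoPrematureBreakdownAt k) → (∀ k : ℕ, 2 ≤ k → WindowCeilingAt k) →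
    AprioriCeiling :=
  fun hN hW => aprioriCeiling_iff_noPrematureBreakdown_and_windowCeiling.2 ⟨hN, hW⟩

/-- The registered upper stub, carried by the two sub-stubs' `sorry`s. -/
theorem stub_apriori_ceiling : AprioriCeiling :=
  AprioriCeiling_of stub_no_premature_breakdown stub_window_ceiling

/-- Losslessness: the registered upper stub gives back both sub-stubs. -/
theorem sub_stubs_of_aprioriCeiling (h : AprioriCeiling) :
    (∀ k : ℕ, 2 ≤ k → NoPrematureBreakdownAt k) ∧ (∀ k : ℕ, 2 ≤ k → WindowCeilingAt k) :=
  aprioriCeiling_iff_noPrematureBreakdown_and_windowCeiling.1 h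

end Summit.NavierStokesRegularity.FluidComputer.PalasekTowerClayBridge.BirthHeredityFromTwo.AprioriCeilingLine
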